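import Summits.QuantumFields.YangMills.Theorems.BalabanUVNodesN15FullPropagatorV1XColouredSiteN15At
import Summits.QuantumFields.YangMills.Theorems.BalabanUVNodesN15SiteColouredAveragingSpecies
import HarnessLib

/-!
# Route «BalabanUVNodes», cluster K4 «SpineRates» — node N15 = NE2: THE SITE LAYER WITH THE BACKGROUND LIVE IN THE TwoGrid ENTRY CURRENCY, XXVIII — THE NON-ABELIAN SITE LAYER WITH
# THE AVERAGING PERTURBATION LIVE: FILE 40's sized gauge-dressed family, site kernel = every colour entry of the coloured site form `(Q ⊗ 1 + F₂(A′))X(A′)²(Q* ⊗ 1 + F₂*(A′))`-words of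
# `G′ ⊗ 1_ι` dressed by the `ad A′`-species (part XXIV), with the coloured linearised averaging species `F₂(A′) = Q∘M_{ad(η Σ_Γ A′)}` (part XXVII) — BOTH read off the gauge field,
# colours MIXED in both; `PairedFamilyGuard.Live ∧ N15At`: the site layer with NO abelianisation and NO species binder

Cell `pub-ymgap`, WIDTH SEAT `pub-ymgap-dag-n15-w1` (generation 3; director-ym №197 ∕ HUMAN RULING D-0149; chair R455 (A) ∕ R461; plan g83 `W-SEAT-START-LIST.md` v11 §n15; (αγ) step 4).
`bears_on: R4∕N15 · K3⁷ SpineGivenEndpointR13SepCoPH (stmt-QuantumFields-20544)`.  Filed `--supports stmt-QuantumFields-20544 --as helper` — COUNT-NEUTRAL.  Three plumbing `def`s (the two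
full coloured perturbation matrices, the `NE2Objects₁₁` literal), the rest theorems; 0 `sorry`.  Imports BY NAME this seat's part XXIV `…N15FullPropagatorV1XColouredSiteN15At` (`adSiteSpeciesF∕C`,
`adSiteSpecies_letters`; through it parts XXI–XXIII, XV, XII, FILE 40, S-E) and part XXVII `…N15SiteColouredAveragingSpecies` (`colAvgFc∕Fsc∕Ff∕Fsf`, `colAvgSpecies_letters`; through it
parts XXV∕XXVI `ne2PlusSite_cSiteExOn_of_sizedSpeciesLettersMF`); nothing in the tree is modified.

CONTENTS.  §1 defs `adSitePertFF ∕ adSitePertFC`; §2 ★★ `ne2PlusSite_v1XAS_colSiteF` (part XXVI §2 ∘ (part XXIV `adSiteSpecies_letters`, part XXVII `colAvgSpecies_letters` at `M_jα₀ ≤ 1`)); §3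
★★★ `n15At_v1XColF`, ★★★ `live_and_n15At_v1XColF`; §4 def `v1XColFObjects` + `live_and_n15At_v1XColFObjects` (`_family`), `populated_v1XColFObjects`, `s_N15_of_admits_v1XColF_family`; §5 POSITIVE CONTROL INSIDE THE
WINDOW ★ `exists_reg335_colSpecies_ne_zero` (if `𝔄` has a non-central element: at every index with `L^mL^k ≥ 2` and every `(c₃₅, α₀)` a (3.35)-REGULAR background at which the `ad`-species AND
the coloured averaging species are non-zero operators — the window's ∀-blocks are met where the layer genuinely depends on the background).

HONEST FRAMING.  Count-neutral KNIT; no new estimate.  MODEL-LEVEL as FILE 40 and parts XXIV∕XXVII say (first-order `ad`-species and first-order matrix contour kernel at the `U ≡ 1`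
geometry, plain block means, King's pairing, starred kernel = unstarred); the unit layer stays part XV's abelianised pair `(0, φ∘A′)`; each kernel reads ONE colour entry `(c, c′)` — every
entry, uniform constants.  NOT Bałaban's `G(U)` with parallel transports ∕ the print's `F′₂ⱼ(A)` at a general (3.35)-regular `U` ([B9] Thms 3.1∕3.2∕3.15 NOT PRINTED as η-rates); Node
00's [B9] layers of record are residual — **N15 is NOT discharged** (typed 28∕28 · discharged 5∕27 of record unchanged); K3⁷ OPEN and not claimed (its v5 pins N15 to `fullGSizedObjects`;
this literal is a re-pin CANDIDATE only); one finite four-torus programme at fixed `ε` — NOT ℝ⁴, NOT infinite volume, NOT OS, NOT a mass gap, NOT Clay; R4 closes the conditional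
finite-𝕋⁴ rung `BalabanLadder.UV` only.  Restate-immune (no Theses import).
-/


set_option autoImplicit false

noncomputable section

open scoped BigOperators Matrix
open Finset

namespace Summit.QuantumFields.YangMills.BalabanUVNodes.N15.SiteLayerBg

open Literature.MathematicalPhysics.QuantumFieldTheory.Balaban1983to89
open Literature.MathematicalPhysics.QuantumFieldTheory.Balaban1983to89.T4Continuum (T4Family ULoop)
open Literature.MathematicalPhysics.QuantumFieldTheory.Balaban1983to89.B11SectG (BlockNorm HasMaj)
open Literature.MathematicalPhysics.QuantumFieldTheory.Balaban1983to89.T4EtaRate (PairedInstance EtaPairing NE2PlusOperator NE2PlusSite NE2PlusUnit)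
open Literature.MathematicalPhysics.QuantumFieldTheory.Balaban1983to89.T4EtaRateDefect (idef)
open Literature.MathematicalPhysics.QuantumFieldTheory.Balaban1983to89.Beta.AveragingCorrectionJets (adCLM adCLM_zero adCLM_smul)
open Literature.MathematicalPhysics.QuantumFieldTheory.Balaban1983to89.T4EtaRateCoeffDefect (pull diagK diagK_mono)
open Literature.MathematicalPhysics.QuantumFieldTheory.Balaban1983to89.B5Prop11Plancherel (Tor fine)
open Literature.MathematicalPhysics.QuantumFieldTheory.Balaban1983to89.B5QGGQ145Bounds (Idx)
open Literature.MathematicalPhysics.QuantumFieldTheory.Balaban1983to89.NE2NodeTorus (ne2PlusOperator_reindex)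
open Literature.MathematicalPhysics.QuantumFieldTheory.King1986.Torus (blockOf)
open Summit.QuantumFields.BalabanUV.T4Continuum.HistoryFlow (two_le_L)
open Summit.QuantumFields.YangMills.BalabanUVNodes.N15.TwoGrid (TGIndex)
open Summit.QuantumFields.YangMills.BalabanUVNodes.N15.VectorPiece (unitTorusGeoS blkFine tensorId)
open Summit.QuantumFields.YangMills.BalabanUVNodes.N15.MatrixSpecies (liftMap liftBlk coordMat basisConst basisConst_nonneg)
open Summit.QuantumFields.YangMills.BalabanUVNodes.N15.BackgroundLayer (fgInstanceV1GS fgFamilyV1XAS reg335_fgInstanceV1GS_const)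
open Summit.QuantumFields.YangMills.BalabanUVNodes.N15.SiteLayer (dressedOp)
open Summit.QuantumFields.YangMills.BalabanUVNodes.N15.GenuineRecord (TGIndexS n15At_v1XAS)
open Summit.QuantumFields.YangMills.BalabanUVNodes.N15.PairedFamilyGuard (Live)
open Summit.QuantumFields.YangMills.BalabanUVNodes.N15.AtKeyedHome (s_N15_of_admits neZero_blockFactor)
open Summit.QuantumFields.YangMills.BalabanUVNodes.N15KingModelRung.Curved (kingGOp kingDOp underPtN)
open YMDAG.UVSplit (Datum RateCarriers RateRecordPred N15At S_N15 ne2OfRecord₁₁)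

variable {d : ℕ} {L : ℕ} [NeZero L]
variable (d) (𝔄 : Type) [NormedRing 𝔄] [NormedAlgebra ℝ 𝔄] [CompleteSpace 𝔄] (ι : Type) [Fintype ι] [DecidableEq ι] [Nonempty ι] (e : 𝔄 ≃L[ℝ] (ι → ℝ)) (φ : 𝔄 →L[ℝ] ℝ)

/-! ## §1 The coloured (3.65) perturbation matrices with BOTH coloured species live -/

section Pert

/-- THE FINE RUN's FULL COLOURED (3.65) SITE PERTURBATION MATRIX on `Idx M × ι`: part XXV's `siteEntriesC (sitePertCF (blockOf ∘ pr lifted) F₂′(A′) F₂*′(A′) (G′ ⊗ 1) (dressedOp (G′ ⊗ 1) (D ⊗ 1) V̂_ad(A′)))`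
— the `ad`-species (part XXIV) AND the coloured averaging species (part XXVII) both read off the gauge field. [cite: Balaban1985BackgroundPropagators, (3.58) p.402, (3.65) p.403 (shape)] -/
def adSitePertFF (hL : Odd L ∧ 1 < L) (aS : ℝ) (j : TGIndexS × Fin (d + 1)) (A : (fgInstanceV1GS d 𝔄 ι hL j).Bf.Cfg) :
    Matrix (Idx (TGIndex.Mn d hL j.1.toTGIndex) × ι) (Idx (TGIndex.Mn d hL j.1.toTGIndex) × ι) ℝ :=
  siteEntriesC (TGIndex.Mn d hL j.1.toTGIndex) ι (sitePertCF (TGIndex.Mn d hL j.1.toTGIndex) ι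
    (liftMap (blockOf (L ^ j.1.k) (TGIndex.Mn d hL j.1.toTGIndex) ∘ underPtN L j.1.k j.1.m (TGIndex.Mn d hL j.1.toTGIndex)) ι)
    (colAvgFf L ι e (TGIndex.Mn d hL j.1.toTGIndex) j.1.k j.1.m A j.2) (colAvgFsf L ι e (TGIndex.Mn d hL j.1.toTGIndex) j.1.k j.1.m A j.2)
    (tensorId ι (kingGOp L aS 0 (j.1.k + j.1.m) (L ^ j.1.m * L ^ j.1.k) (TGIndex.Mn d hL j.1.toTGIndex)))
    (dressedOp (tensorId ι (kingGOp L aS 0 (j.1.k + j.1.m) (L ^ j.1.m * L ^ j.1.k) (TGIndex.Mn d hL j.1.toTGIndex)))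
      (fun μ => tensorId ι (kingDOp L aS 0 (j.1.k + j.1.m) (L ^ j.1.m * L ^ j.1.k) (TGIndex.Mn d hL j.1.toTGIndex) μ)) (adSiteSpeciesF d 𝔄 ι e hL j A)))

/-- THE COARSE RUN's FULL COLOURED (3.65) SITE PERTURBATION MATRIX. [cite: Balaban1985BackgroundPropagators, (3.58) p.402, (3.65) p.403 (shape)] -/
def adSitePertFC (hL : Odd L ∧ 1 < L) (aS : ℝ) (j : TGIndexS × Fin (d + 1)) (B : (fgInstanceV1GS d 𝔄 ι hL j).Bc.Cfg) :
    Matrix (Idx (TGIndex.Mn d hL j.1.toTGIndex) × ι) (Idx (TGIndex.Mn d hL j.1.toTGIndex) × ι) ℝ :=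
  siteEntriesC (TGIndex.Mn d hL j.1.toTGIndex) ι (sitePertCF (TGIndex.Mn d hL j.1.toTGIndex) ι (liftMap (blockOf (L ^ j.1.k) (TGIndex.Mn d hL j.1.toTGIndex)) ι)
    (colAvgFc L ι e (TGIndex.Mn d hL j.1.toTGIndex) j.1.k B j.2) (colAvgFsc L ι e (TGIndex.Mn d hL j.1.toTGIndex) j.1.k B j.2)
    (tensorId ι (kingGOp L aS 0 j.1.k (L ^ j.1.k) (TGIndex.Mn d hL j.1.toTGIndex)))
    (dressedOp (tensorId ι (kingGOp L aS 0 j.1.k (L ^ j.1.k) (TGIndex.Mn d hL j.1.toTGIndex))) (fun μ => tensorId ι (kingDOp L aS 0 j.1.k (L ^ j.1.k) (TGIndex.Mn d hL j.1.toTGIndex) μ))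
      (adSiteSpeciesC d 𝔄 ι e hL j B)))

end Pert

/-! ## §2 ★★ `NE2PlusSite` for every colour entry on the sized family, both coloured species live -/


section Site

omit [CompleteSpace 𝔄] [Nonempty ι] in
/-- ★★ **`NE2PlusSite` FOR EVERY COLOUR ENTRY OF THE `ad`-DRESSED COLOURED SITE KERNEL ON FILE 40's SIZED GAUGE-DRESSED FAMILY** (sub-index `m ≥ 1`, colour selectors `(c, c′)`): part XXIII §3 ∘ §2.
`d ≥ 0`, odd `L ≥ 3`, `a_S > 0`, `c₃₅ ≥ 0`. [cite: Balaban1985BackgroundPropagators, Thm 3.2 (3.48) p.398 + Thm 3.14 pp.426–427 (quantifier template), (3.52) p.400, (3.63)–(3.67) pp.402–403 (mechanism); Balaban1984PropagatorsI, (1.45) p.26; King1986, Prop. 3.8 (3.71) p.664] -/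
theorem ne2PlusSite_v1XAS_colSiteF (hLodd : Odd L) (hL2 : 2 ≤ L) (hL : Odd L ∧ 1 < L) {aS : ℝ} (haS : 0 < aS) {c35 : ℝ} (hc35 : 0 ≤ c35) (p : ℝ) (c c' : V1IndexSM d → ι) :
    NE2PlusSite 4 p c35 (fun j : V1IndexSM d => fgInstanceV1GS d 𝔄 ι hL j.1)
      (cSiteExOn ι (fun j : V1IndexSM d => TGIndex.Mn d hL j.1.1.toTGIndex) (fun j => j.1.1.k) (fun j => j.1.1.m) (fun j => j.1.1.Msz)
        (fun j => (Tor (fine (L ^ j.1.1.k) (TGIndex.Mn d hL j.1.1.toTGIndex)) × Fin (d + 1)) × ι) (fun j => liftBlk (blkFine L j.1.1.k (TGIndex.Mn d hL j.1.1.toTGIndex)) ι)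
        (fun j => (fgInstanceV1GS d 𝔄 ι hL j.1).gf) (fun j => (fgInstanceV1GS d 𝔄 ι hL j.1).Bc) (fun j => (fgInstanceV1GS d 𝔄 ι hL j.1).Bf) aS
        (fun j => (fgInstanceV1GS d 𝔄 ι hL j.1).pair) (fun j A => adSitePertFF d 𝔄 ι e hL aS j.1 A) (fun j B => adSitePertFC d 𝔄 ι e hL aS j.1 B) c c') := by
  refine ne2PlusSite_cSiteExOn_of_sizedSpeciesLettersMF (L := L) ι (fun j : V1IndexSM d => TGIndex.Mn d hL j.1.1.toTGIndex) (fun j => j.1.1.k) (fun j => j.1.1.m) (fun j => j.1.1.Msz)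
    (fun j => (Tor (fine (L ^ j.1.1.k) (TGIndex.Mn d hL j.1.1.toTGIndex)) × Fin (d + 1)) × ι) (fun j => liftBlk (blkFine L j.1.1.k (TGIndex.Mn d hL j.1.1.toTGIndex)) ι)
    (fun j => (fgInstanceV1GS d 𝔄 ι hL j.1).gf) (fun j => (fgInstanceV1GS d 𝔄 ι hL j.1).Bc) (fun j => (fgInstanceV1GS d 𝔄 ι hL j.1).Bf)
    (fun j => adSiteSpeciesC d 𝔄 ι e hL j.1) (fun j => adSiteSpeciesF d 𝔄 ι e hL j.1)
    (fun j B => colAvgFc L ι e (TGIndex.Mn d hL j.1.1.toTGIndex) j.1.1.k B j.1.2) (fun j B => colAvgFsc L ι e (TGIndex.Mn d hL j.1.1.toTGIndex) j.1.1.k B j.1.2)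
    (fun j A => colAvgFf L ι e (TGIndex.Mn d hL j.1.1.toTGIndex) j.1.1.k j.1.1.m A j.1.2) (fun j A => colAvgFsf L ι e (TGIndex.Mn d hL j.1.1.toTGIndex) j.1.1.k j.1.1.m A j.1.2)
    hLodd hL2 haS c35 4 p one_half_pos (by norm_num) (mT := fun j => j.1.1.mT)
    (fun _ _ => rfl) (fun j => j.1.1.one_le) (fun j => j.2) (fun j => j.1.1.one_le_Msz) (fun j => (fgInstanceV1GS d 𝔄 ι hL j.1).pair)
    ⟨4 * ((d : ℝ) + 1) * ((d : ℝ) + 2) * basisConst e * c35, 1, by have := basisConst_nonneg e; positivity, one_pos,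
      fun j α₀ hα₀ _ A hA => adSiteSpecies_letters d 𝔄 ι e hL hc35 (by norm_num) j.1 hα₀ A hA⟩
    ⟨2 * ((d : ℝ) + 1) * (2 * (d : ℝ) + 3) * basisConst e * c35, 2 * ((d : ℝ) + 1) * (2 * (d : ℝ) + 3) * basisConst e * c35, 1,
      by have := basisConst_nonneg e; positivity, by have := basisConst_nonneg e; positivity, one_pos, fun j α₀ hα₀ hs A hA => ?_⟩ c c'
  obtain ⟨h1, h2, h3, h4, h5, h6⟩ := colAvgSpecies_letters d 𝔄 ι e hL hc35 (by norm_num : (1 : ℝ) / 2 ≤ 2) j.1 hα₀ A hA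
  have hθ : 0 ≤ ((L : ℝ) ^ j.1.1.k) ^ (-((1 : ℝ) / 2 / 2)) := Real.rpow_nonneg (pow_nonneg (Nat.cast_nonneg _) _) _
  have hK : 0 ≤ 2 * ((d : ℝ) + 1) * (2 * (d : ℝ) + 3) * basisConst e * c35 := by have := basisConst_nonneg e; positivity
  have hfit : 2 * ((d : ℝ) + 1) * (2 * (d : ℝ) + 3) * basisConst e * c35 * (j.1.1.Msz * α₀) * ((L : ℝ) ^ j.1.1.k) ^ (-((1 : ℝ) / 2 / 2))
      ≤ 2 * ((d : ℝ) + 1) * (2 * (d : ℝ) + 3) * basisConst e * c35 * ((L : ℝ) ^ j.1.1.k) ^ (-((1 : ℝ) / 2 / 2)) := by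
    have : 2 * ((d : ℝ) + 1) * (2 * (d : ℝ) + 3) * basisConst e * c35 * (j.1.1.Msz * α₀) ≤ 2 * ((d : ℝ) + 1) * (2 * (d : ℝ) + 3) * basisConst e * c35 := by nlinarith
    exact mul_le_mul_of_nonneg_right this hθ
  exact ⟨h1, h2, h3, h4, h5.mono fun y y' => diagK_mono (fun _ => hfit) y y', h6.mono fun y y' => diagK_mono (fun _ => hfit) y y'⟩

end Site

/-! ## §3 ★★★ `Live ∧ N15At` with the non-abelian site layer, averaging perturbation live -/

section Knit

/-- ★★★ **`N15At` FOR THE SIZED GAUGE-DRESSED FAMILY WITH THE NON-ABELIAN (`ad`-DRESSED, COLOURED) SITE LAYER** (sub-index `m ≥ 1`, colour entry `(c, c′)`): OPERATOR = FILE 40 `fgFamilyV1XAS`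
(S-E `n15At_v1XAS`'s first conjunct, reindexed), SITE = §3, UNIT = part XV `ne2PlusUnit_v1CovBgEx`.  `d ≥ 1`, odd `L ≥ 3`, `b, a_S, c₃₅ > 0`, `|φ| ≤ ‖·‖`. [bookkeeping] -/
theorem n15At_v1XColF (hd : 1 ≤ d) (hLodd : Odd L) (hL2 : 2 ≤ L) (hL : Odd L ∧ 1 < L) {b aS c35 : ℝ} (hb : 0 < b) (haS : 0 < aS) (hc35 : 0 < c35)
    (hφ : ∀ a : 𝔄, |φ a| ≤ ‖a‖) (α β : Fin (d + 1)) (p : ℝ) (c c' : V1IndexSM d → ι) :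
    N15At { I := V1IndexSM d, c35 := c35, p := p, pi := fun j => fgInstanceV1GS d 𝔄 ι hL j.1, Kop := fun j => fgFamilyV1XAS d 𝔄 ι e hL b j.1,
            Ksite := cSiteExOn ι (fun j : V1IndexSM d => TGIndex.Mn d hL j.1.1.toTGIndex) (fun j => j.1.1.k) (fun j => j.1.1.m) (fun j => j.1.1.Msz)
              (fun j => (Tor (fine (L ^ j.1.1.k) (TGIndex.Mn d hL j.1.1.toTGIndex)) × Fin (d + 1)) × ι) (fun j => liftBlk (blkFine L j.1.1.k (TGIndex.Mn d hL j.1.1.toTGIndex)) ι)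
              (fun j => (fgInstanceV1GS d 𝔄 ι hL j.1).gf) (fun j => (fgInstanceV1GS d 𝔄 ι hL j.1).Bc) (fun j => (fgInstanceV1GS d 𝔄 ι hL j.1).Bf) aS
              (fun j => (fgInstanceV1GS d 𝔄 ι hL j.1).pair) (fun j A => adSitePertFF d 𝔄 ι e hL aS j.1 A) (fun j B => adSitePertFC d 𝔄 ι e hL aS j.1 B) c c',
            Kunit := fun j => v1CovBgEx d 𝔄 ι φ hL b α β j.1, inΛ := fun _ _ => True, unitDist := fun j => (fgInstanceV1GS d 𝔄 ι hL j.1).gc.dist } := by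
  have h := n15At_v1XAS 𝔄 ι e hd hLodd hL2 hL hb haS hc35 α β p
  exact ⟨ne2PlusOperator_reindex (fun j : V1IndexSM d => j.1) h.1, ne2PlusSite_v1XAS_colSiteF d 𝔄 ι e hLodd hL2 hL haS hc35.le p c c',
    ne2PlusUnit_v1CovBgEx d 𝔄 ι φ hd hLodd hL2 hL hb hc35 hφ α β⟩

/-- ★★★ **GUARD ∧ `N15At` — THE `Live` SIZE-LIVE FAMILY WITH THE NON-ABELIAN SITE LAYER** (operator: FILE 40's `ad`-species; site: §3's `ad`-dressed coloured massless site propagator, colour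
entry `(c, c′)`; unit: part XV's exactly dressed (2.156) kernel): `d ≥ 1`, odd `L ≥ 3`, `b, a_S, c₃₅ > 0`, `|φ| ≤ ‖·‖`. [bookkeeping] -/
theorem live_and_n15At_v1XColF (hd : 1 ≤ d) (hLodd : Odd L) (hL2 : 2 ≤ L) (hL : Odd L ∧ 1 < L) {b aS c35 : ℝ} (hb : 0 < b) (haS : 0 < aS) (hc35 : 0 < c35)
    (hφ : ∀ a : 𝔄, |φ a| ≤ ‖a‖) (α β : Fin (d + 1)) (p : ℝ) (c c' : V1IndexSM d → ι) :
    Live ⟨V1IndexSM d, c35, p, fun j => fgInstanceV1GS d 𝔄 ι hL j.1, fun j => fgFamilyV1XAS d 𝔄 ι e hL b j.1,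
        cSiteExOn ι (fun j : V1IndexSM d => TGIndex.Mn d hL j.1.1.toTGIndex) (fun j => j.1.1.k) (fun j => j.1.1.m) (fun j => j.1.1.Msz)
          (fun j => (Tor (fine (L ^ j.1.1.k) (TGIndex.Mn d hL j.1.1.toTGIndex)) × Fin (d + 1)) × ι) (fun j => liftBlk (blkFine L j.1.1.k (TGIndex.Mn d hL j.1.1.toTGIndex)) ι)
          (fun j => (fgInstanceV1GS d 𝔄 ι hL j.1).gf) (fun j => (fgInstanceV1GS d 𝔄 ι hL j.1).Bc) (fun j => (fgInstanceV1GS d 𝔄 ι hL j.1).Bf) aS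
          (fun j => (fgInstanceV1GS d 𝔄 ι hL j.1).pair) (fun j A => adSitePertFF d 𝔄 ι e hL aS j.1 A) (fun j B => adSitePertFC d 𝔄 ι e hL aS j.1 B) c c',
        fun j => v1CovBgEx d 𝔄 ι φ hL b α β j.1, fun _ _ => True, fun j => (fgInstanceV1GS d 𝔄 ι hL j.1).gc.dist⟩ ∧
      N15At { I := V1IndexSM d, c35 := c35, p := p, pi := fun j => fgInstanceV1GS d 𝔄 ι hL j.1, Kop := fun j => fgFamilyV1XAS d 𝔄 ι e hL b j.1,
              Ksite := cSiteExOn ι (fun j : V1IndexSM d => TGIndex.Mn d hL j.1.1.toTGIndex) (fun j => j.1.1.k) (fun j => j.1.1.m) (fun j => j.1.1.Msz)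
                (fun j => (Tor (fine (L ^ j.1.1.k) (TGIndex.Mn d hL j.1.1.toTGIndex)) × Fin (d + 1)) × ι) (fun j => liftBlk (blkFine L j.1.1.k (TGIndex.Mn d hL j.1.1.toTGIndex)) ι)
                (fun j => (fgInstanceV1GS d 𝔄 ι hL j.1).gf) (fun j => (fgInstanceV1GS d 𝔄 ι hL j.1).Bc) (fun j => (fgInstanceV1GS d 𝔄 ι hL j.1).Bf) aS
                (fun j => (fgInstanceV1GS d 𝔄 ι hL j.1).pair) (fun j A => adSitePertFF d 𝔄 ι e hL aS j.1 A) (fun j B => adSitePertFC d 𝔄 ι e hL aS j.1 B) c c',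
              Kunit := fun j => v1CovBgEx d 𝔄 ι φ hL b α β j.1, inΛ := fun _ _ => True, unitDist := fun j => (fgInstanceV1GS d 𝔄 ι hL j.1).gc.dist } :=
  ⟨live_v1XAS_site d 𝔄 ι hL hc35.le p _ _ _, n15At_v1XColF d 𝔄 ι e φ hd hLodd hL2 hL hb haS hc35 hφ α β p c c'⟩

end Knit

/-! ## §4 The `NE2Objects₁₁` literal of the family and its keyed faces (part XV's pattern) -/

section Record

/-- **N15's NE2 OBJECTS OF THE SIZED GAUGE-DRESSED FAMILY WITH THE NON-ABELIAN SITE LAYER** (RR-1's layer-A container): part XV's `v1XAllObjects` with the site kernel the `ad`-dressed coloured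
site socket at the colour entry `(c, c′)`. [bookkeeping] -/
def v1XColFObjects (hL : Odd L ∧ 1 < L) (b aS : ℝ) (α β : Fin (d + 1)) (c35 p : ℝ) (c c' : V1IndexSM d → ι) : Node00.NE2Objects₁₁ where
  I := V1IndexSM d
  c35 := c35
  p := p
  pi := fun j => fgInstanceV1GS d 𝔄 ι hL j.1
  Kop := fun j => fgFamilyV1XAS d 𝔄 ι e hL b j.1
  Ksite := cSiteExOn ι (fun j : V1IndexSM d => TGIndex.Mn d hL j.1.1.toTGIndex) (fun j => j.1.1.k) (fun j => j.1.1.m) (fun j => j.1.1.Msz)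
    (fun j => (Tor (fine (L ^ j.1.1.k) (TGIndex.Mn d hL j.1.1.toTGIndex)) × Fin (d + 1)) × ι) (fun j => liftBlk (blkFine L j.1.1.k (TGIndex.Mn d hL j.1.1.toTGIndex)) ι)
    (fun j => (fgInstanceV1GS d 𝔄 ι hL j.1).gf) (fun j => (fgInstanceV1GS d 𝔄 ι hL j.1).Bc) (fun j => (fgInstanceV1GS d 𝔄 ι hL j.1).Bf) aS
    (fun j => (fgInstanceV1GS d 𝔄 ι hL j.1).pair) (fun j A => adSitePertFF d 𝔄 ι e hL aS j.1 A) (fun j B => adSitePertFC d 𝔄 ι e hL aS j.1 B) c c'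
  Kunit := fun j => v1CovBgEx d 𝔄 ι φ hL b α β j.1
  inΛ := fun _ _ => True
  unitDist := fun j => (fgInstanceV1GS d 𝔄 ι hL j.1).gc.dist

variable {d}

/-- ★★★ **`Live ∧ N15At` AT THE OBJECTS' BUNDLE** (`d ≥ 1`, odd `L ≥ 3`, `b, a_S, c₃₅ > 0`, `|φ| ≤ ‖·‖`, any colour entry). [bookkeeping] -/
theorem live_and_n15At_v1XColFObjects (hd : 1 ≤ d) (hLodd : Odd L) (hL2 : 2 ≤ L) (hL : Odd L ∧ 1 < L) {b aS c35 : ℝ} (hb : 0 < b) (haS : 0 < aS) (hc35 : 0 < c35)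
    (hφ : ∀ a : 𝔄, |φ a| ≤ ‖a‖) (α β : Fin (d + 1)) (p : ℝ) (c c' : V1IndexSM d → ι) :
    Live (ne2OfRecord₁₁ (v1XColFObjects d 𝔄 ι e φ hL b aS α β c35 p c c')) ∧ N15At (ne2OfRecord₁₁ (v1XColFObjects d 𝔄 ι e φ hL b aS α β c35 p c c')) :=
  live_and_n15At_v1XColF d 𝔄 ι e φ hd hLodd hL2 hL hb haS hc35 hφ α β p c c'

omit [CompleteSpace 𝔄] [Nonempty ι] in
/-- RR-1's display: the objects are `Populated`. [bookkeeping] -/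
theorem populated_v1XColFObjects (hL : Odd L ∧ 1 < L) (b aS : ℝ) (α β : Fin (d + 1)) (c35 p : ℝ) (c c' : V1IndexSM d → ι) :
    (v1XColFObjects d 𝔄 ι e φ hL b aS α β c35 p c c').Populated :=
  (Node00.NE2Objects₁₁.populated_iff _).2 (v1IndexSM_nonempty d)

/-- `Live ∧ N15At` at the family-keyed literal (`d + 1 = 4`, the datum's own block factor `F.L`), for colour selectors given per family. [bookkeeping] -/
theorem live_and_n15At_v1XColFObjects_family {b aS c35 : ℝ} (hb : 0 < b) (haS : 0 < aS) (hc35 : 0 < c35) (hφ : ∀ a : 𝔄, |φ a| ≤ ‖a‖) (α β : Fin 4) (p : ℝ)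
    (c c' : V1IndexSM 3 → ι) (F : T4Family) :
    Live (ne2OfRecord₁₁ (haveI := neZero_blockFactor F; v1XColFObjects 3 𝔄 ι e φ F.hL b aS α β c35 p c c')) ∧
      N15At (ne2OfRecord₁₁ (haveI := neZero_blockFactor F; v1XColFObjects 3 𝔄 ι e φ F.hL b aS α β c35 p c c')) := by
  haveI := neZero_blockFactor F
  exact live_and_n15At_v1XColFObjects (d := 3) 𝔄 ι e φ (by norm_num) F.hL.1 (two_le_L F) F.hL hb haS hc35 hφ α β p c c'

variable {N : ℕ} [NeZero N] {key : (F : T4Family) → Datum F N → Prop}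

/-- ★★ **THE FAMILY-KEYED READING CLOSES THE STUB AT ANY KEYED HOME** (part 30's interface; `d + 1 = 4`, the datum's own block factor): a home admitting only the literals of a key-indexed NE2
reading whose value everywhere IS `v1XColFObjects 3 …` has `S_N15 RRec` — the estimate is §4, not a hypothesis. [bookkeeping] -/
theorem s_N15_of_admits_v1XColF_family {b aS c35 : ℝ} (hb : 0 < b) (haS : 0 < aS) (hc35 : 0 < c35) (hφ : ∀ a : 𝔄, |φ a| ≤ ‖a‖) (α β : Fin 4) (p : ℝ) (c c' : V1IndexSM 3 → ι)
    (ne2At : ∀ {F : T4Family} {D : Datum F N}, key F D → (ℕ → ℝ) → List (ULoop F) → ℕ → Node00.NE2Objects₁₁) (RRec : RateRecordPred N)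
    (hadm : ∀ (F : T4Family) (D : Datum F N) (g₀ : ℕ → ℝ) (os : List (ULoop F)) (R : RateCarriers N), RRec F D g₀ os R →
      ∃ (h : key F D) (k : ℕ), R.ne2 = ne2OfRecord₁₁ (ne2At h g₀ os k))
    (h : ∀ (F : T4Family) (D : Datum F N) (h : key F D) (g₀ : ℕ → ℝ) (os : List (ULoop F)) (k : ℕ),
      ne2At h g₀ os k = haveI := neZero_blockFactor F; v1XColFObjects 3 𝔄 ι e φ F.hL b aS α β c35 p c c') :
    S_N15 RRec := by
  refine s_N15_of_admits ne2At RRec hadm fun F D hk g₀ os k => ?_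
  rw [h F D hk g₀ os k]
  exact (live_and_n15At_v1XColFObjects_family 𝔄 ι e φ hb haS hc35 hφ α β p c c' F).2

end Record

/-! ## §5 Positive control inside the window: a (3.35)-regular background at which both coloured species are non-zero -/

section WindowControl

omit [CompleteSpace 𝔄] [Nonempty ι] in
/-- ★ **THE POSITIVE CONTROLS LIVE INSIDE EVERY (3.35) WINDOW OF THE FAMILY.**  If `𝔄` has a non-central element (`∃ a, ad a ≠ 0` — any non-abelian matrix Lie algebra), then for every
index `(j, ν)` with `L^mL^k ≥ 2`, every `c₃₅ > 0` and every `α₀ > 0` there is a fine gauge field `A′` (the constant field at a rescaled non-central element, FILE 40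
`reg335_fgInstanceV1GS_const`) which IS (3.35)-regular at `(c₃₅, α₀)` for the sized instance AND at which part XXIV's `ad`-species `V̂(A′)` and part XXVII's coloured averaging species
`F₂′(A′)` are both NON-ZERO operators (`adSiteSpeciesF_const_ne_zero`, `colAvgFf_const_ne_zero`).  So the `∀ A′ ∈ window` blocks behind §§2–4 are met by backgrounds at which the
coloured site layer genuinely depends on the background — the family is not secretly the `U ≡ 1` layer. [folklore] -/
theorem exists_reg335_colSpecies_ne_zero (hL : Odd L ∧ 1 < L) (j : TGIndexS × Fin (d + 1)) {c35 α₀ : ℝ} (hc35 : 0 < c35) (hα₀ : 0 < α₀) (hn : 2 ≤ L ^ j.1.m * L ^ j.1.k)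
    (h𝔄 : ∃ a : 𝔄, adCLM ℝ a ≠ 0) :
    ∃ A : (fgInstanceV1GS d 𝔄 ι hL j).Bf.Cfg, (fgInstanceV1GS d 𝔄 ι hL j).Bf.Reg335 c35 α₀ A ∧ adSiteSpeciesF d 𝔄 ι e hL j A ≠ 0 ∧
      colAvgFf L ι e (TGIndex.Mn d hL j.1.toTGIndex) j.1.k j.1.m A j.2 ≠ 0 := by
  obtain ⟨a, ha⟩ := h𝔄
  have ha0 : a ≠ 0 := fun h => ha (by rw [h, adCLM_zero])
  have hna : 0 < ‖a‖ := norm_pos_iff.2 ha0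
  have hr : 0 < c35 * (j.1.Msz * α₀) := by have := j.1.one_le_Msz; positivity
  have ht : 0 < c35 * (j.1.Msz * α₀) / ‖a‖ := div_pos hr hna
  have hta : adCLM ℝ ((c35 * (j.1.Msz * α₀) / ‖a‖) • a) ≠ 0 := by
    rw [adCLM_smul]; exact smul_ne_zero ht.ne' ha
  refine ⟨fun _ _ => (c35 * (j.1.Msz * α₀) / ‖a‖) • a, reg335_fgInstanceV1GS_const d 𝔄 ι hL j hc35.le hα₀.le _ ?_,
    adSiteSpeciesF_const_ne_zero d 𝔄 ι e hL j hta, colAvgFf_const_ne_zero L ι e (TGIndex.Mn d hL j.1.toTGIndex) j.1.k j.1.m hn hta j.2⟩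
  rw [norm_smul, Real.norm_of_nonneg ht.le, div_mul_cancel₀ _ hna.ne']

end WindowControl

end Summit.QuantumFields.YangMills.BalabanUVNodes.N15.SiteLayerBg

end
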